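import Literature.Probability.FitznerVanDerHofstad2017.SawCountTables
import HarnessLib

set_option Elab.async false  -- one kernel evaluation at a time (bounded memory on the farm)

/-!
# Kernel-certified SAW end-point counts `c_n(x)` on `ℤ^d`, uniformly in `d` — `c_10(x)`, `x ∼ (1,1,1,1,1,1,1,3)` (published class outside the stage-1 types) — part 4/5

Continuation of `SawCountTables` (see there for the method and references): the ten-step class `x ∼ (1,1,1,1,1,1,1,3)` (seven ones and a three) of the published table. Part 4 of 5: self-contained kernel pieces (leaf evaluations) only — the parts a, b, c, d are independent of each other; part e assembles them into the theorem.
Each coefficient is one `decide +kernel` evaluation of `sawCodeF`; no facts, no hypotheses beyond `s ≤ d`.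
-/

namespace Literature.Probability.FitznerVanDerHofstad2017

open Finset Literature.Probability.LatticeModels Literature.Probability.Percolation

variable {d : ℕ}

/-! #### Kernel pieces for `card_sawWordsTo_n10_x11111113` (part 4) -/

set_option maxHeartbeats 0 in
/-- Kernel piece (child) (13700 nodes). [folklore] -/
theorem card_sawWordsTo_n10_x11111113_k420 : minusChild 7 0 8 164834820905867543767340756113505 8 (nextV 164834820905867543771738802624609 (nextV 164834820905867543776136849135713 0)) [164834820905867543771738802624609, 164834820905867543776136849135713] 5 = 5040 := by
  decide +kernel

/-- Still-born child (1 nodes). [folklore] -/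
theorem card_sawWordsTo_n10_x11111113_k421 : plusChild 7 0 8 164834820905867543767340756113505 8 (nextV 164834820905867543771738802624609 (nextV 164834820905867543776136849135713 0)) [164834820905867543771738802624609, 164834820905867543776136849135713] 6 = 0 := by
  decide +kernel

set_option maxHeartbeats 0 in
/-- Kernel piece (child) (13700 nodes). [folklore] -/
theorem card_sawWordsTo_n10_x11111113_k422 : minusChild 7 0 8 164834820905867543767340756113505 8 (nextV 164834820905867543771738802624609 (nextV 164834820905867543776136849135713 0)) [164834820905867543771738802624609, 164834820905867543776136849135713] 6 = 5040 := by
  decide +kernel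

/-- Still-born child (1 nodes). [folklore] -/
theorem card_sawWordsTo_n10_x11111113_k423 : plusChild 7 0 8 164834820905867543767340756113505 8 (nextV 164834820905867543771738802624609 (nextV 164834820905867543776136849135713 0)) [164834820905867543771738802624609, 164834820905867543776136849135713] 7 = 0 := by
  decide +kernel

set_option maxHeartbeats 0 in
/-- Kernel piece (child) (13700 nodes). [folklore] -/
theorem card_sawWordsTo_n10_x11111113_k424 : minusChild 7 0 8 164834820905867543767340756113505 8 (nextV 164834820905867543771738802624609 (nextV 164834820905867543776136849135713 0)) [164834820905867543771738802624609, 164834820905867543776136849135713] 7 = 5040 := by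
  decide +kernel

/-- No fresh child at `j = 0`. [folklore] -/
theorem card_sawWordsTo_n10_x11111113_k425 : freshChild 7 0 8 164834820905867543767340756113505 8 (nextV 164834820905867543771738802624609 (nextV 164834820905867543776136849135713 0)) [164834820905867543771738802624609, 164834820905867543776136849135713] = 0 := by
  decide +kernel

/-- No fresh child at `j = 0`. [folklore] -/
theorem card_sawWordsTo_n10_x11111113_k428 : freshChild 8 0 8 164834820905867543771738802624609 9 (nextV 164834820905867543776136849135713 0) [164834820905867543776136849135713] = 0 := by
  decide +kernel

/-- No fresh child at `j = 0`. [folklore] -/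
theorem card_sawWordsTo_n10_x11111113_k431 : freshChild 9 0 8 164834820905867543776136849135713 10 0 [] = 0 := by
  decide +kernel

end Literature.Probability.FitznerVanDerHofstad2017
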